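import Summits.ABC.StewartYu.SatFrameKit
import HarnessLib

/-!
# No sub-product of a saturated basis is a square (plan R32 (a), interface (1))

Support file (theorems only; no named facts). Cell `abc-stewartyu`, route `YuMatveevShapeRat` (A1.L), crux r2 `ArchCoreRat`
one-stage architecture (R32): the half-step's `2`-independence hypothesis at `S(θ)` — the `hind` of
`ArchG3HalfSeparation.halfClassVec_eq_zero_of_norm_lt` (`∀ T ≠ ∅, ¬ IsSquare ∏_T θⱼ`) — is a COROLLARY of the `q = 2`
saturation clause of `SatFrameKit.exists_satFrame` plus independence (`∏_T θ = y² ⇒ ±y = θ^c ⇒ 𝟙_T = 2c ⇒ T = ∅`);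
no Kummer clause on the original `α`. Seat p1 (START package owner).

## References
* [Nesterenko2003] Yu. V. Nesterenko, LNM 1819 (2003) — §4.3 Lemma 4.4 / Cor 4.5 (a basis of `𝔑` is Kummer for free).
-/

namespace Summit.ABC.StewartYu

namespace SatFrameKit

open Finset

variable {n : ℕ}

/-- **No non-empty sub-product of a `2`-saturated independent basis is a square** (`θᵢ ≠ 0`): the `hind` hypothesis of
`ArchG3HalfSeparation.halfClassVec_eq_zero_of_norm_lt` at `S(θ)` from the `q = 2` clause of `SatFrameKit.exists_satFrame`
(`∏_T θ = y² ⇒ ±y = θ^c ⇒ 𝟙_T = 2c ⇒ T = ∅`). The non-vanishing hypothesis is necessary (`n = 1`, `θ = 0` satisfies the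
other two and `∏_{{0}} θ = 0` is a square). [cite: Nesterenko2003, §4.3 Cor 4.5; shape only] -/
theorem not_isSquare_prod_of_satFrame (θ : Fin n → ℚ) (hθ : ∀ i, θ i ≠ 0)
    (hind : ∀ μ : Fin n → ℤ, ∏ i, θ i ^ μ i = 1 → μ = 0)
    (hsat2 : ∀ γ : ℚ, (∃ c : Fin n → ℤ, γ ^ 2 = ∏ i, θ i ^ c i) →
      ∃ c : Fin n → ℤ, γ = ∏ i, θ i ^ c i ∨ -γ = ∏ i, θ i ^ c i) :
    ∀ T : Finset (Fin n), T.Nonempty → ¬ IsSquare (∏ j ∈ T, θ j) := by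
  classical
  rintro T ⟨j₀, hj₀⟩ ⟨y, hy⟩
  set κ : Fin n → ℤ := fun i => if i ∈ T then 1 else 0 with hκ
  have hprod : ∏ i, θ i ^ κ i = ∏ j ∈ T, θ j := by
    have h' : ∀ i, θ i ^ κ i = if i ∈ T then θ i else 1 := fun i => by
      simp only [hκ]; split_ifs <;> simp
    simp_rw [h']
    rw [Finset.prod_ite_mem, Finset.univ_inter]
  have hy2 : y ^ 2 = ∏ i, θ i ^ κ i := by rw [hprod, hy, sq]
  obtain ⟨c, hc⟩ := hsat2 y ⟨κ, hy2⟩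
  have hc2 : y ^ 2 = ∏ i, θ i ^ (2 * c i) := by
    have h' : y ^ 2 = (∏ i, θ i ^ c i) ^ 2 := by
      rcases hc with h | h
      · rw [← h]
      · rw [← h, neg_sq]
    rw [h', ← Finset.prod_pow]
    refine Finset.prod_congr rfl fun i _ => ?_
    rw [← zpow_natCast, ← zpow_mul, mul_comm]
    rfl
  have h1 : ∏ i, θ i ^ (κ i - 2 * c i) = 1 := by
    simp_rw [zpow_sub₀ (hθ _)]
    rw [Finset.prod_div_distrib, ← hc2, hy2, div_self]
    exact Finset.prod_ne_zero_iff.mpr fun i _ => zpow_ne_zero _ (hθ i)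
  have h2 := congrFun (hind _ h1) j₀
  simp only [hκ, if_pos hj₀, Pi.zero_apply] at h2
  omega

/-- The same for a POSITIVE basis in the `∀ q` saturation currency of `exists_satFrame` /
`SatBasisReduced.exists_reduced_satFrame`. [cite: Nesterenko2003, §4.3 Cor 4.5; shape only] -/
theorem not_isSquare_prod_of_sat (θ : Fin n → ℚ) (hθ : ∀ i, 0 < θ i)
    (hind : ∀ μ : Fin n → ℤ, ∏ i, θ i ^ μ i = 1 → μ = 0)
    (hsat : ∀ q : ℕ, 0 < q → ∀ γ : ℚ, (∃ c : Fin n → ℤ, γ ^ q = ∏ i, θ i ^ c i) →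
      ∃ c : Fin n → ℤ, γ = ∏ i, θ i ^ c i ∨ -γ = ∏ i, θ i ^ c i)
    (T : Finset (Fin n)) (hT : T.Nonempty) : ¬ IsSquare (∏ j ∈ T, θ j) :=
  not_isSquare_prod_of_satFrame θ (fun i => (hθ i).ne') hind (hsat 2 two_pos) T hT

end SatFrameKit

end Summit.ABC.StewartYu
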